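import Mathlib
import HarnessLib
import Summits.HubbardSuperconductivity.HubbardSuperconductivity.Theorems.KLProgrammeKLRegimeEngineDressedDataHarmonics
import Summits.HubbardSuperconductivity.HubbardSuperconductivity.Theorems.KLProgrammeC4aAliasingJetLemma
import Summits.HubbardSuperconductivity.HubbardSuperconductivity.Theorems.KLProgrammeKLRegimeEngineMomentTail

/-!
# K3 gen-8-FLOW (stmt 20437, stub (C), «(C)-B-REP» sup route S-d, generic layer 3): THE DRESSED ALIASING LEMMA — for lattice data
# `f(k) = Re(g(p_k)·H(k))` with `g` smooth `2π`-periodic `D₄`-symmetric VANISHING NEAR `q` and `H` any lattice factor with position moments,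
# `‖Dʲ[evalM (symInterp L f)](q)‖ ≤ 4·M_j(H)·3ʲ·D_g·(2/N)^{M−j−4}·4C₂ + L^{j+2}·‖g‖_∞·M_s(H)/(1+L/4)ˢ` — pure aliasing, `tiny(L)`

Cell gate-hubbard-kl, seat p2 g14 (assembly `…EngineFrameShiftDressingSup`, pen (R59ap)/(R59bl)).  Composition of: layer 2
(`eval_symInterp_dressed_eq_harmonics`: the interpolant sees `f` as the samples of `F(q) = Σ_x Re(g(q)Ȟ(x))·h_x(q)`; `exists_trigPoly_of_near_harmonics`:
the near harmonics `4|x̃ᵢ| ≤ L` in the `(B,c)` cosine currency), c4a-1's generic aliasing-jet lemma `…C4aAliasingJetLemma` (p575152: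
`norm_iteratedFDeriv_evalM_symInterp_mul_trigPoly_le` + `quarterTail_weighted_le` + `norm_partialDeriv_iterate_symbolFlat_le` + `summable_weighted_symbolFlat_of_deriv`)
applied to `Re g·P₁` and `Im g·P₂` (first term ZERO: `g` vanishes near `q`), and the far coefficients `|x̃|_∞ > L/4` by pure moments (`…SplitSymInterpPureMoments`)
times the coefficient tail `…EngineMomentTail` (p569678):

* §1 `re`/`im` bookkeeping for `g` (periodicity, symmetry, smoothness, `‖D^M Re g‖ ≤ ‖D^M g‖`); §2 the far part `norm_iteratedFDeriv_evalM_symInterp_farHarmonics_le`;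
* §3 **`norm_iteratedFDeriv_evalM_symInterp_dressed_le`** — THE DRESSED ALIASING LEMMA (statement in the title; `N = 2(L/4+1)`,
  `C₂ = Σ'_{k∈ℤ²} Πᵢ(1+kᵢ²)⁻¹`, `M_j(H) = Σ_x (1+|x̃₀|+|x̃₁|)ʲ‖𝔉⁻¹H(x)‖`, `4 + j ≤ M`, `‖D^M g‖ ≤ D_g`, `‖g‖ ≤ A₀`).

Pure harmonic analysis on the tree's objects; no symmetry of `H` or of the model is assumed; nothing about the Hubbard model is asserted.
References: BGM 2006 §2.3 (2.17) [cite: BenfattoGiulianiMastropietro2006]; Boyd 2001 §4.5 Thm 19–20 [cite: Boyd2001]; Grafakos 2014 §3.3.3 [cite: Grafakos2014].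
-/

noncomputable section

namespace Summit.HubbardSuperconductivity.HubbardSuperconductivity.Theorems.EngineV8

set_option linter.dupNamespace false -- summit = problem name (single-conjunct summit), D-0017

open Real Finset Filter Literature.MathematicalPhysics.QuantumLattice Literature.Probability.LatticeModels
open Summit.HubbardSuperconductivity.HubbardSuperconductivity.Theorems.KLRegimeSplit
open Summit.HubbardSuperconductivity.HubbardSuperconductivity.Theorems.C4a
open scoped ComplexConjugate

variable {L : ℕ} [NeZero L]

/-! ## §1 Real and imaginary parts of the smooth factor -/

section ReIm

variable {g : Momentum → ℂ}

omit [NeZero L] in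
/-- `‖D^M (Re g)‖ ≤ ‖D^M g‖` and `‖D^M (Im g)‖ ≤ ‖D^M g‖`. -/
theorem norm_iteratedFDeriv_re_im_le (hg : ContDiff ℝ (⊤ : ℕ∞) g) (M : ℕ) (q : Momentum) :
    ‖iteratedFDeriv ℝ M (fun q => (g q).re) q‖ ≤ ‖iteratedFDeriv ℝ M g q‖ ∧ ‖iteratedFDeriv ℝ M (fun q => (g q).im) q‖ ≤ ‖iteratedFDeriv ℝ M g q‖ := by
  have hN : ((M : ℕ∞) : WithTop ℕ∞) ≤ ((⊤ : ℕ∞) : WithTop ℕ∞) := by exact_mod_cast le_top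
  constructor
  · have h := Complex.reCLM.norm_iteratedFDeriv_comp_left (f := g) (x := q) (n := M) hg.contDiffAt hN
    have e : (fun q => (g q).re) = fun q => Complex.reCLM (g q) := rfl
    rw [e]
    refine h.trans ?_
    rw [Complex.reCLM_norm, one_mul]
  · have h := Complex.imCLM.norm_iteratedFDeriv_comp_left (f := g) (x := q) (n := M) hg.contDiffAt hN
    have e : (fun q => (g q).im) = fun q => Complex.imCLM (g q) := rfl
    rw [e]
    refine h.trans ?_
    rw [Complex.imCLM_norm, one_mul]

omit [NeZero L] in
/-- A function vanishing near `q` times anything has all its derivatives zero at `q`. -/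
theorem iteratedFDeriv_mul_eq_zero_of_eventually {a P : Momentum → ℝ} {q : Momentum} (ha : ∀ᶠ q' in nhds q, a q' = 0) (j : ℕ) :
    iteratedFDeriv ℝ j (fun q => a q * P q) q = 0 := by
  have hev : (fun q => a q * P q) =ᶠ[nhds q] fun _ => (0 : ℝ) := ha.mono fun q' h => by simp only [h, zero_mul]
  rw [(hev.iteratedFDeriv ℝ j).eq_of_nhds, iteratedFDeriv_fun_zero]
  rfl

end ReIm

/-! ## §2 The far harmonics by pure moments -/

/-- The far sites `¬(∀ i, 4|x̃ᵢ| ≤ L)` lie in the tail set `L/4 < |x̃₀| ∨ L/4 < |x̃₁|` of `…EngineMomentTail`. -/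
theorem farSites_subset :
    (univ.filter fun x : TorusSite 2 L => ¬ ∀ i, 4 * |(x i).valMinAbs| ≤ (L : ℤ)) ⊆
      univ.filter (fun x : TorusSite 2 L => (L : ℝ) / 4 < ((x 0).valMinAbs.natAbs : ℝ) ∨ (L : ℝ) / 4 < ((x 1).valMinAbs.natAbs : ℝ)) := by
  intro x hx
  rw [mem_filter] at hx ⊢
  refine ⟨mem_univ _, ?_⟩
  obtain ⟨i, hi⟩ := not_forall.1 hx.2
  have hlt : (L : ℝ) / 4 < ((x i).valMinAbs.natAbs : ℝ) := by
    have h : (L : ℤ) < 4 * |(x i).valMinAbs| := not_le.1 hi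
    have h' : ((L : ℤ) : ℝ) < ((4 * |(x i).valMinAbs| : ℤ) : ℝ) := by exact_mod_cast h
    rw [Nat.cast_natAbs]
    push_cast at h' ⊢
    linarith
  fin_cases i
  · exact Or.inl hlt
  · exact Or.inr hlt

/-- **The far harmonics by pure moments**: for lattice samples `G` with `‖G‖ ≤ A₀` and site weights `b` with `Σ_{x far}‖b(x)‖ ≤ T`,
`‖Dʲ[evalM (symInterp L (k ↦ Σ_{x far} Re(G(k)b(x))·h_x(p_k)))](q)‖ ≤ L²·Lʲ·(A₀·T)`. -/
theorem norm_iteratedFDeriv_evalM_symInterp_farHarmonics_le (G : TorusSite 2 L → ℂ) {A₀ : ℝ} (hA₀ : ∀ k, ‖G k‖ ≤ A₀) (b : TorusSite 2 L → ℂ)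
    (S : Finset (TorusSite 2 L)) {T : ℝ} (hT : ∑ x ∈ S, ‖b x‖ ≤ T) (j : ℕ) (q : Momentum) :
    ‖iteratedFDeriv ℝ j (evalM (symInterp L (fun k => ∑ x ∈ S, (G k * b x).re *
        TrigPolyC4v.harmonic (x 0).valMinAbs.natAbs (x 1).valMinAbs.natAbs (latticeMomentum L k)))) q‖ ≤
      (L : ℝ) ^ 2 * (L : ℝ) ^ j * (A₀ * T) := by
  have hA0 : 0 ≤ A₀ := (norm_nonneg _).trans (hA₀ 0)
  -- sup of the data
  have hsup : ∀ k, |∑ x ∈ S, (G k * b x).re * TrigPolyC4v.harmonic (x 0).valMinAbs.natAbs (x 1).valMinAbs.natAbs (latticeMomentum L k)| ≤ A₀ * T := by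
    intro k
    refine (abs_sum_le_sum_abs _ _).trans ?_
    calc ∑ x ∈ S, |(G k * b x).re * TrigPolyC4v.harmonic (x 0).valMinAbs.natAbs (x 1).valMinAbs.natAbs (latticeMomentum L k)|
        ≤ ∑ x ∈ S, A₀ * ‖b x‖ := sum_le_sum fun x _ => by
          rw [abs_mul]
          calc |(G k * b x).re| * |TrigPolyC4v.harmonic (x 0).valMinAbs.natAbs (x 1).valMinAbs.natAbs (latticeMomentum L k)|
              ≤ ‖G k * b x‖ * 1 := mul_le_mul (Complex.abs_re_le_norm _) (TrigPolyC4v.abs_harmonic_le_one _ _ _) (abs_nonneg _) (norm_nonneg _)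
            _ ≤ A₀ * ‖b x‖ := by rw [mul_one, norm_mul]; exact mul_le_mul_of_nonneg_right (hA₀ k) (norm_nonneg _)
      _ = A₀ * ∑ x ∈ S, ‖b x‖ := (mul_sum _ _ _).symm
      _ ≤ A₀ * T := mul_le_mul_of_nonneg_left hT hA0
  refine (norm_iteratedFDeriv_evalM_symInterp_le_pure_moments L _ j q).trans ?_
  have hcard : (Finset.univ : Finset (TorusSite 2 L)).card = L ^ 2 := by simp [TorusSite, ZMod.card, Finset.card_univ]
  calc ∑ y : TorusSite 2 L, (((y 0).valMinAbs.natAbs : ℝ) + ((y 1).valMinAbs.natAbs : ℝ)) ^ j *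
          |torusCosCoeff L (fun k => ∑ x ∈ S, (G k * b x).re *
            TrigPolyC4v.harmonic (x 0).valMinAbs.natAbs (x 1).valMinAbs.natAbs (latticeMomentum L k)) y|
      ≤ ∑ _y : TorusSite 2 L, (L : ℝ) ^ j * (A₀ * T) := by
        refine sum_le_sum fun y _ => mul_le_mul (pow_le_pow_left₀ (by positivity) ?_ j) (abs_torusCosCoeff_le_of_forall_abs_le L hsup y)
          (abs_nonneg _) (by positivity)
        have h0 := ZMod.natAbs_valMinAbs_le (y 0)
        have h1 := ZMod.natAbs_valMinAbs_le (y 1)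
        have h : (y 0).valMinAbs.natAbs + (y 1).valMinAbs.natAbs ≤ L := by omega
        exact_mod_cast h
    _ = (L : ℝ) ^ 2 * (L : ℝ) ^ j * (A₀ * T) := by rw [sum_const, hcard, nsmul_eq_mul]; push_cast; ring

/-! ## §3 The dressed aliasing lemma -/

/-- **THE DRESSED ALIASING LEMMA.**  `g : Momentum → ℂ` smooth, `2π`-periodic in each coordinate, reflection- and swap-symmetric, vanishing on a
neighbourhood of `q`, with `‖D^M g‖ ≤ D_g` everywhere (`4 + j ≤ M`) and `‖g‖ ≤ A₀`; `H` ANY lattice factor with position moments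
`Σ_x (1+|x̃₀|+|x̃₁|)ʲ‖𝔉⁻¹H(x)‖ ≤ M_j`, `Σ_x (1+|x̃₀|+|x̃₁|)ˢ‖𝔉⁻¹H(x)‖ ≤ M_s`.  Then the `j`-th momentum jet at `q` of the symmetrised interpolant of the dressed
data `k ↦ Re(g(p_k)·H(k))` is pure aliasing:
`‖Dʲ[evalM (symInterp L Re(g∘p·H))](q)‖ ≤ 2·(2·M_j·(3ʲ·D_g·(2/N)^{M−j−4}·(4·C₂))) + L²·Lʲ·(A₀·M_s/(1+L/4)ˢ)`, `N = 2(L/4+1)`. -/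
theorem norm_iteratedFDeriv_evalM_symInterp_dressed_le {g : Momentum → ℂ}
    (hgper : ∀ (i : Fin 2) (q : Momentum), g (q + EuclideanSpace.single i (2 * π)) = g q) (hg : ContDiff ℝ (⊤ : ℕ∞) g)
    (hrefl : ∀ p : Fin 2 → ℝ, g (WithLp.toLp 2 ![p 0, -p 1]) = g (WithLp.toLp 2 p))
    (hswap : ∀ p : Fin 2 → ℝ, g (WithLp.toLp 2 ![p 1, p 0]) = g (WithLp.toLp 2 p))
    (H : TorusSite 2 L → ℂ) {j M : ℕ} (hM : 4 + j ≤ M) {Dg : ℝ} (hDg : ∀ q, ‖iteratedFDeriv ℝ M g q‖ ≤ Dg) {A₀ : ℝ} (hA₀ : ∀ q, ‖g q‖ ≤ A₀)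
    {Mj : ℝ} (hMj : ∑ x : TorusSite 2 L, (1 + ((x 0).valMinAbs.natAbs : ℝ) + ((x 1).valMinAbs.natAbs : ℝ)) ^ j * ‖torusFourierInv H x‖ ≤ Mj)
    {s : ℕ} {Ms : ℝ} (hMs : ∑ x : TorusSite 2 L, (1 + ((x 0).valMinAbs.natAbs : ℝ) + ((x 1).valMinAbs.natAbs : ℝ)) ^ s * ‖torusFourierInv H x‖ ≤ Ms)
    {q : Momentum} (hvan : ∀ᶠ q' in nhds q, g q' = 0) :
    ‖iteratedFDeriv ℝ j (evalM (symInterp L (fun k : TorusSite 2 L => (g (WithLp.toLp 2 (latticeMomentum L k)) * H k).re))) q‖ ≤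
      2 * (2 * (Mj * ((3 : ℝ) ^ j * Dg * (2 / ((2 * (L / 4 + 1) : ℕ) : ℝ)) ^ (M - j - 4) *
        (2 ^ 2 * ∑' k : Fin 2 → ℤ, ∏ i, (1 + (k i : ℝ) ^ 2)⁻¹)))) +
        (L : ℝ) ^ 2 * (L : ℝ) ^ j * (A₀ * (Ms / (1 + (L : ℝ) / 4) ^ s)) := by
  classical
  -- names
  set G : TorusSite 2 L → ℂ := fun k => g (WithLp.toLp 2 (latticeMomentum L k)) with hG
  set near : Finset (TorusSite 2 L) := univ.filter (fun x : TorusSite 2 L => ∀ i, 4 * |(x i).valMinAbs| ≤ (L : ℤ)) with hnear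
  set far : Finset (TorusSite 2 L) := univ.filter (fun x : TorusSite 2 L => ¬ ∀ i, 4 * |(x i).valMinAbs| ≤ (L : ℤ)) with hfar
  set gre : Momentum → ℝ := fun q => (g q).re with hgre
  set gim : Momentum → ℝ := fun q => (g q).im with hgim
  set P₁ : Momentum → ℝ := fun q => ∑ x ∈ near, (torusFourierInv H x).re * TrigPolyC4v.harmonic (x 0).valMinAbs.natAbs (x 1).valMinAbs.natAbs (WithLp.ofLp q)
    with hP₁
  set P₂ : Momentum → ℝ := fun q => ∑ x ∈ near, (torusFourierInv H x).im * TrigPolyC4v.harmonic (x 0).valMinAbs.natAbs (x 1).valMinAbs.natAbs (WithLp.ofLp q)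
    with hP₂
  set ffar : TorusSite 2 L → ℝ := fun k => ∑ x ∈ far, (G k * torusFourierInv H x).re *
    TrigPolyC4v.harmonic (x 0).valMinAbs.natAbs (x 1).valMinAbs.natAbs (latticeMomentum L k) with hffar
  -- `G` is `B₂`-invariant
  have hGn : ∀ k, G (-k) = G k := fun k => sample_comp_neg hgper hrefl hswap k
  have hGr : ∀ k, G ![k 0, -k 1] = G k := fun k => sample_comp_reflect hgper hrefl k
  have hGs : ∀ k, G ![k 1, k 0] = G k := fun k => sample_comp_swap (L := L) hswap k
  -- the data split: `Re(G·H) ↦ (Re g·P₁ − Im g·P₂)∘p + far`, under the interpolant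
  have hsplit : ∀ k : TorusSite 2 L, (∑ x : TorusSite 2 L, (G k * torusFourierInv H x).re *
      TrigPolyC4v.harmonic (x 0).valMinAbs.natAbs (x 1).valMinAbs.natAbs (latticeMomentum L k)) =
      ((fun q => gre q * P₁ q) (WithLp.toLp 2 (latticeMomentum L k)) - (fun q => gim q * P₂ q) (WithLp.toLp 2 (latticeMomentum L k))) + ffar k := by
    intro k
    rw [← sum_filter_add_sum_filter_not univ (fun x : TorusSite 2 L => ∀ i, 4 * |(x i).valMinAbs| ≤ (L : ℤ))]
    simp only [hgre, hgim, hP₁, hP₂, hffar, hG, mul_sum, ← sum_sub_distrib]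
    congr 1
    refine sum_congr rfl fun x _ => ?_
    rw [Complex.mul_re]
    ring
  have hfun : evalM (symInterp L (fun k : TorusSite 2 L => (g (WithLp.toLp 2 (latticeMomentum L k)) * H k).re)) = fun q' =>
      (evalM (symInterp L (fun k => (fun q => gre q * P₁ q) (WithLp.toLp 2 (latticeMomentum L k)))) q' -
        evalM (symInterp L (fun k => (fun q => gim q * P₂ q) (WithLp.toLp 2 (latticeMomentum L k)))) q') +
        evalM (symInterp L ffar) q' := by
    funext q'
    rw [evalM_apply, eval_symInterp_dressed_eq_harmonics G H hGn hGr hGs]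
    simp_rw [hsplit]
    rw [eval_symInterp_add L _ ffar, eval_symInterp_sub L]
    rfl
  -- smoothness of the three interpolants and the splitting of the jet
  have hN : ((j : ℕ∞) : WithTop ℕ∞) ≤ ((⊤ : ℕ∞) : WithTop ℕ∞) := by exact_mod_cast le_top
  have hc1 : ContDiff ℝ j (evalM (symInterp L (fun k => (fun q => gre q * P₁ q) (WithLp.toLp 2 (latticeMomentum L k))))) := contDiff_evalM _
  have hc2 : ContDiff ℝ j (evalM (symInterp L (fun k => (fun q => gim q * P₂ q) (WithLp.toLp 2 (latticeMomentum L k))))) := contDiff_evalM _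
  have hc3 : ContDiff ℝ j (evalM (symInterp L ffar)) := contDiff_evalM _
  rw [hfun, fun_iteratedFDeriv_add_apply (hc1.sub hc2).contDiffAt hc3.contDiffAt, fun_iteratedFDeriv_sub_apply hc1.contDiffAt hc2.contDiffAt]
  refine (norm_add_le _ _).trans (add_le_add ((norm_sub_le _ _).trans ?_) ?_)
  · -- the two main terms through c4a-1's generic lemma
    have hgre_per : ∀ (i : Fin 2) (q : Momentum), gre (q + EuclideanSpace.single i (2 * π)) = gre q := fun i q => by
      simp only [hgre, hgper]
    have hgim_per : ∀ (i : Fin 2) (q : Momentum), gim (q + EuclideanSpace.single i (2 * π)) = gim q := fun i q => by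
      simp only [hgim, hgper]
    have hgre_sm : ContDiff ℝ (⊤ : ℕ∞) gre := Complex.reCLM.contDiff.comp hg
    have hgim_sm : ContDiff ℝ (⊤ : ℕ∞) gim := Complex.imCLM.contDiff.comp hg
    have hDre : ∀ q, ‖iteratedFDeriv ℝ M gre q‖ ≤ Dg := fun q => ((norm_iteratedFDeriv_re_im_le hg M q).1).trans (hDg q)
    have hDim : ∀ q, ‖iteratedFDeriv ℝ M gim q‖ ≤ Dg := fun q => ((norm_iteratedFDeriv_re_im_le hg M q).2).trans (hDg q)
    have hflat_re : ∀ (i : Fin 2) (t : UnitAddTorus (Fin 2)),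
        ‖((Literature.Analysis.FunctionSpaces.Torus.partialDeriv i)^[M] (symbolFlat gre hgre_per)) t‖ ≤ (2 * π) ^ M * Dg :=
      norm_partialDeriv_iterate_symbolFlat_le hgre_per hgre_sm hDre
    have hflat_im : ∀ (i : Fin 2) (t : UnitAddTorus (Fin 2)),
        ‖((Literature.Analysis.FunctionSpaces.Torus.partialDeriv i)^[M] (symbolFlat gim hgim_per)) t‖ ≤ (2 * π) ^ M * Dg :=
      norm_partialDeriv_iterate_symbolFlat_le hgim_per hgim_sm hDim
    have hw_re := summable_weighted_symbolFlat_of_deriv hgre_per hgre_sm hM hflat_re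
    have hw_im := summable_weighted_symbolFlat_of_deriv hgim_per hgim_sm hM hflat_im
    have hG_re := quarterTail_weighted_le (L := L) hgre_per hgre_sm hM hflat_re
    have hG_im := quarterTail_weighted_le (L := L) hgim_per hgim_sm hM hflat_im
    have hDg0 : 0 ≤ Dg := (norm_nonneg _).trans (hDg q)
    have h2π : (2 * π) ^ M * Dg / (2 * π) ^ M = Dg := by field_simp
    rw [h2π] at hG_re hG_im
    -- the near polynomials in the `(B,c)` currency
    obtain ⟨B₁, c₁, hB₁, hP₁', hM₁⟩ := exists_trigPoly_of_near_harmonics (L := L) (fun x => (torusFourierInv H x).re)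
    obtain ⟨B₂, c₂, hB₂, hP₂', hM₂⟩ := exists_trigPoly_of_near_harmonics (L := L) (fun x => (torusFourierInv H x).im)
    have hP₁q : ∀ q : Momentum, P₁ q = ∑ y ∈ B₁, c₁ y * Real.cos (∑ i : Fin 2, (y i : ℝ) * q i) := fun q => hP₁' (WithLp.ofLp q)
    have hP₂q : ∀ q : Momentum, P₂ q = ∑ y ∈ B₂, c₂ y * Real.cos (∑ i : Fin 2, (y i : ℝ) * q i) := fun q => hP₂' (WithLp.ofLp q)
    -- symmetry of the two products
    have hh : ∀ (x : TorusSite 2 L) (p : Fin 2 → ℝ),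
        TrigPolyC4v.harmonic (x 0).valMinAbs.natAbs (x 1).valMinAbs.natAbs ![p 0, -p 1] =
          TrigPolyC4v.harmonic (x 0).valMinAbs.natAbs (x 1).valMinAbs.natAbs p ∧
        TrigPolyC4v.harmonic (x 0).valMinAbs.natAbs (x 1).valMinAbs.natAbs ![p 1, p 0] =
          TrigPolyC4v.harmonic (x 0).valMinAbs.natAbs (x 1).valMinAbs.natAbs p :=
      fun x p => ⟨TrigPolyC4v.harmonic_reflect _ _ p, TrigPolyC4v.harmonic_swap _ _ p⟩
    have hrefl₁ : ∀ p : Fin 2 → ℝ, (fun q => gre q * P₁ q) (WithLp.toLp 2 ![p 0, -p 1]) = (fun q => gre q * P₁ q) (WithLp.toLp 2 p) := by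
      intro p; simp only [hgre, hP₁, hrefl, (hh _ p).1]
    have hswap₁ : ∀ p : Fin 2 → ℝ, (fun q => gre q * P₁ q) (WithLp.toLp 2 ![p 1, p 0]) = (fun q => gre q * P₁ q) (WithLp.toLp 2 p) := by
      intro p; simp only [hgre, hP₁, hswap, (hh _ p).2]
    have hrefl₂ : ∀ p : Fin 2 → ℝ, (fun q => gim q * P₂ q) (WithLp.toLp 2 ![p 0, -p 1]) = (fun q => gim q * P₂ q) (WithLp.toLp 2 p) := by
      intro p; simp only [hgim, hP₂, hrefl, (hh _ p).1]
    have hswap₂ : ∀ p : Fin 2 → ℝ, (fun q => gim q * P₂ q) (WithLp.toLp 2 ![p 1, p 0]) = (fun q => gim q * P₂ q) (WithLp.toLp 2 p) := by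
      intro p; simp only [hgim, hP₂, hswap, (hh _ p).2]
    -- vanishing of the continuum products near `q`
    have hvre : ∀ᶠ q' in nhds q, gre q' = 0 := hvan.mono fun q' h => by simp only [hgre, h, Complex.zero_re]
    have hvim : ∀ᶠ q' in nhds q, gim q' = 0 := hvan.mono fun q' h => by simp only [hgim, h, Complex.zero_im]
    have hz₁ := iteratedFDeriv_mul_eq_zero_of_eventually (P := P₁) hvre j
    have hz₂ := iteratedFDeriv_mul_eq_zero_of_eventually (P := P₂) hvim j
    -- c4a-1's lemma, twice
    have h₁ := norm_iteratedFDeriv_evalM_symInterp_mul_trigPoly_le hgre_per hgre_sm B₁ c₁ hB₁ hP₁q hrefl₁ hswap₁ hw_re le_rfl q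
    have h₂ := norm_iteratedFDeriv_evalM_symInterp_mul_trigPoly_le hgim_per hgim_sm B₂ c₂ hB₂ hP₂q hrefl₂ hswap₂ hw_im le_rfl q
    rw [hz₁, norm_zero, zero_add] at h₁
    rw [hz₂, norm_zero, zero_add] at h₂
    -- the moments of the aggregated coefficients
    have hwt : ∀ x : TorusSite 2 L, 0 ≤ (1 + ((x 0).valMinAbs.natAbs : ℝ) + ((x 1).valMinAbs.natAbs : ℝ)) ^ j := fun x => by positivity
    have hMre : ∑ y ∈ B₁, |c₁ y| * (1 + |((y 0 : ℤ) : ℝ)| + |((y 1 : ℤ) : ℝ)|) ^ j ≤ Mj := by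
      refine (hM₁ j).trans (le_trans ?_ hMj)
      refine (sum_le_sum_of_subset_of_nonneg (filter_subset _ _) fun x _ _ => by positivity).trans (sum_le_sum fun x _ => ?_)
      rw [mul_comm]
      exact mul_le_mul_of_nonneg_left (Complex.abs_re_le_norm _) (hwt x)
    have hMim : ∑ y ∈ B₂, |c₂ y| * (1 + |((y 0 : ℤ) : ℝ)| + |((y 1 : ℤ) : ℝ)|) ^ j ≤ Mj := by
      refine (hM₂ j).trans (le_trans ?_ hMj)
      refine (sum_le_sum_of_subset_of_nonneg (filter_subset _ _) fun x _ _ => by positivity).trans (sum_le_sum fun x _ => ?_)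
      rw [mul_comm]
      exact mul_le_mul_of_nonneg_left (Complex.abs_im_le_norm _) (hwt x)
    have hGpos : 0 ≤ (3 : ℝ) ^ j * Dg * (2 / ((2 * (L / 4 + 1) : ℕ) : ℝ)) ^ (M - j - 4) * (2 ^ 2 * ∑' k : Fin 2 → ℤ, ∏ i, (1 + (k i : ℝ) ^ 2)⁻¹) := by
      have : 0 ≤ ∑' k : Fin 2 → ℤ, ∏ i, (1 + (k i : ℝ) ^ 2)⁻¹ := tsum_nonneg fun k => prod_nonneg fun i _ => by positivity
      positivity
    have hM1pos : 0 ≤ ∑ y ∈ B₁, |c₁ y| * (1 + |((y 0 : ℤ) : ℝ)| + |((y 1 : ℤ) : ℝ)|) ^ j := sum_nonneg fun y _ => by positivity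
    have hM2pos : 0 ≤ ∑ y ∈ B₂, |c₂ y| * (1 + |((y 0 : ℤ) : ℝ)| + |((y 1 : ℤ) : ℝ)|) ^ j := sum_nonneg fun y _ => by positivity
    calc ‖iteratedFDeriv ℝ j (evalM (symInterp L fun k => (fun q => gre q * P₁ q) (WithLp.toLp 2 (latticeMomentum L k)))) q‖ +
          ‖iteratedFDeriv ℝ j (evalM (symInterp L fun k => (fun q => gim q * P₂ q) (WithLp.toLp 2 (latticeMomentum L k)))) q‖
        ≤ 2 * ((∑ y ∈ B₁, |c₁ y| * (1 + |((y 0 : ℤ) : ℝ)| + |((y 1 : ℤ) : ℝ)|) ^ j) *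
            ((3 : ℝ) ^ j * Dg * (2 / ((2 * (L / 4 + 1) : ℕ) : ℝ)) ^ (M - j - 4) * (2 ^ 2 * ∑' k : Fin 2 → ℤ, ∏ i, (1 + (k i : ℝ) ^ 2)⁻¹))) +
          2 * ((∑ y ∈ B₂, |c₂ y| * (1 + |((y 0 : ℤ) : ℝ)| + |((y 1 : ℤ) : ℝ)|) ^ j) *
            ((3 : ℝ) ^ j * Dg * (2 / ((2 * (L / 4 + 1) : ℕ) : ℝ)) ^ (M - j - 4) * (2 ^ 2 * ∑' k : Fin 2 → ℤ, ∏ i, (1 + (k i : ℝ) ^ 2)⁻¹))) := by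
          refine add_le_add (h₁.trans ?_) (h₂.trans ?_)
          · exact mul_le_mul_of_nonneg_left (mul_le_mul_of_nonneg_left hG_re hM1pos) (by norm_num)
          · exact mul_le_mul_of_nonneg_left (mul_le_mul_of_nonneg_left hG_im hM2pos) (by norm_num)
      _ ≤ 2 * (2 * (Mj * ((3 : ℝ) ^ j * Dg * (2 / ((2 * (L / 4 + 1) : ℕ) : ℝ)) ^ (M - j - 4) *
            (2 ^ 2 * ∑' k : Fin 2 → ℤ, ∏ i, (1 + (k i : ℝ) ^ 2)⁻¹)))) := by
          nlinarith [mul_le_mul_of_nonneg_right hMre hGpos, mul_le_mul_of_nonneg_right hMim hGpos]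
  · -- the far part
    have hA₀' : ∀ k : TorusSite 2 L, ‖G k‖ ≤ A₀ := fun k => hA₀ _
    have hR : (0 : ℝ) ≤ (L : ℝ) / 4 := by positivity
    have hT : ∑ x ∈ far, ‖torusFourierInv H x‖ ≤ Ms / (1 + (L : ℝ) / 4) ^ s := by
      have h := sum_far_momentWeight_norm_torusFourierInv_le H (j := 0) (s := s) (Nat.zero_le _) hR hMs
      simp only [pow_zero, one_mul, Nat.sub_zero] at h
      exact (sum_le_sum_of_subset_of_nonneg farSites_subset fun x _ _ => norm_nonneg _).trans h
    exact norm_iteratedFDeriv_evalM_symInterp_farHarmonics_le G hA₀' (torusFourierInv H) far hT j q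

end Summit.HubbardSuperconductivity.HubbardSuperconductivity.Theorems.EngineV8

end
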